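import Summits.QuantumFields.YangMills.Theorems.FemtoTransferGapSpectralSums
import Summits.QuantumFields.YangMills.Theorems.LuscherReductionRunningReductionKTPhysSpace
import Summits.QuantumFields.YangMills.Theorems.FlatTubeReductionOffTubeSuppressionPrelim
import Summits.QuantumFields.YangMills.Theorems.LuscherReductionOneSiteLevelsIMS
import HarnessLib

/-!
# The `m`-step deficit bound: `λ₁^m ≥ λ₀^m − D_m(g)/Var_Ω(g)` — ONE coarse time step = `M` fine time steps
# (crux `DyadicNestedUpper` stmt-QuantumFields-25766 of route `FemtoCutoffLadder`, LINE 1 of seat ym-idea-1 g4; rung R2b1 = RECORD-label femto gap;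
# seat ym-line-sfw-p1 g10, `--supports stmt-QuantumFields-25766`)

The comparison of `DyadicNestedUpper` is between ONE transfer step on the coarse lattice `(ℤ/L')³` and `M = 2^k` transfer steps on the fine lattice
`(ℤ/ML')³` (same physical time).  The Dirichlet principle of `…DyadicNestedUpperDirichlet.lean` is the case `m = 1` of the following ITERATED form,
proved here from the tree's exact spectral sums (`SpecSum.exists_spectral_eigenseq`): for `β > 0`, a normalised exact ground state `K_βΩ = λ₀Ω`,
a bounded measurable gauge- and twist-invariant multiplier `g` with `Var_Ω(g) = ‖gΩ‖² − ⟨gΩ,Ω⟩² > 0`, and every `m ≥ 1`,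

  ★★ `λ₁^m · Var_Ω(g) ≥ λ₀^m · Var_Ω(g) − D_m(g)`,   `D_m(g) = λ₀^m‖gΩ‖² − ⟨gΩ, K_β^m (gΩ)⟩`  (`pow_secondValue_ge_deficit`),

the `m`-STEP DEFICIT of the trial multiplier (for `m = 1`, `D_1 = ℰ_Ω(g)` is the ground-state Dirichlet energy).  Mechanism: the centred trial state
`ψ = (g − ⟨gΩ,Ω⟩)Ω` is physical and orthogonal to `Ω`, hence (simplicity of `λ₀`, `secondValue_lt_topValue`) to the top vector of the spectral
eigen-sequence; its `m`-step Rayleigh quotient is dominated by `λ₁^m` (`l2_iterate_le_of_orth_ground`), and equals `λ₀^m − D_m/Var` by bilinearity and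
`K^mΩ = λ₀^mΩ`.  With `g = g' ∘ B_M` (the pulled-back ratio of the coarse top pair, `…Pullback.lean`, `…Dirichlet.lean §3`) and `m = M` this is the
per-COARSE-step form of the trial-function step of 25766: `(λ₁,f/λ₀,f)^M ≥ 1 − D_M(g'∘B_M)/(λ₀,f^M · Var)`, to be compared with the EXACT coarse identity
`λ₁'/λ₀' = 1 − D_1(g')/λ₀'` — the remaining statement is the RG comparison of the blocked `M`-step fine deficit with the one-step coarse deficit.

HONEST FRAMING: fixed-lattice spectral bookkeeping; no two-cutoff statement is proved; R2b1 is a RECORD rung — nothing here concerns infinite volume,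
the continuum, or the Clay Yang–Mills mass gap.  No definitions, no named facts, no `sorry`.
References: Reed–Simon IV, Thm. XIII.1–2 [cite: ReedSimonIV1978, Thm. XIII.1]; Reed–Simon I, Thm. VI.16 [cite: ReedSimonI1980, Thm. VI.16].
-/

set_option autoImplicit false

noncomputable section

open MeasureTheory Filter Topology Real
open Literature.MathematicalPhysics.QuantumFieldTheory
open Literature.MathematicalPhysics.QuantumLattice

namespace Summit.QuantumFields.YangMills.Theorems.FemtoTransferGap

namespace Deficit

open OffTube

variable {L : ℕ} [NeZero L]

/-- Iterates of an exact eigenfunction: `K_β^m Ω = λ^m Ω`. [folklore] -/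
theorem iterate_transferApply_eigen (β : ℝ) {Ω : GaugeConfig 3 L SU2 → ℝ} {lam : ℝ} (heig : transferApply β Ω = lam • Ω) (m : ℕ) :
    (transferApply β)^[m] Ω = lam ^ m • Ω := by
  induction m with
  | zero => simp
  | succ m ih => rw [Function.iterate_succ_apply', ih, transferApply_smul, heig, smul_smul, pow_succ, mul_comm]

/-- Bilinear expansion `⟨f + aΩ, h + cΩ⟩ = ⟨f,h⟩ + c⟨f,Ω⟩ + a⟨Ω,h⟩ + ac‖Ω‖²` for physical arguments. [folklore] -/
theorem l2_add_smul_add_smul {f h Ω : GaugeConfig 3 L SU2 → ℝ} (hf : IsPhys f) (hh : IsPhys h) (hΩ : IsPhys Ω) (a c : ℝ) :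
    l2 (f + a • Ω) (h + c • Ω) = l2 f h + c * l2 f Ω + a * l2 Ω h + a * c * l2 Ω Ω := by
  have h1 : l2 f (h + c • Ω) = l2 h f + c * l2 Ω f := by
    rw [l2_comm, l2_add_left hh (hΩ.smul c) hf, l2_smul_left]
  have h2 : l2 Ω (h + c • Ω) = l2 h Ω + c * l2 Ω Ω := by
    rw [l2_comm, l2_add_left hh (hΩ.smul c) hΩ, l2_smul_left]
  rw [l2_add_left hf (hΩ.smul a) (hh.add (hΩ.smul c)), l2_smul_left, h1, h2, l2_comm h f, l2_comm Ω f, l2_comm h Ω]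
  ring

/-- ★ **Domination of the `m`-step Rayleigh quotient on `Ω^⊥`.**  For `β > 0`, a normalised exact ground state `K_βΩ = λ₀Ω` and a physical `ψ ⊥ Ω`:
`⟨ψ, K_β^m ψ⟩ ≤ λ₁^m‖ψ‖²` (`m ≥ 1`).  Spectral sums: `⟨ψ,K^mψ⟩ = Σ_k λ_k^m⟨ψ,e_k⟩²` with `⟨ψ,e_0⟩ = 0` — the top vector `e_0` of the eigen-sequence is `±Ω` in
`L²` by simplicity of `λ₀` — and `λ_k ≤ λ₁` for `k ≥ 1`, plus Bessel. [cite: ReedSimonIV1978, Thm. XIII.1] -/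
theorem l2_iterate_le_of_orth_ground {β : ℝ} (hβ : 0 < β) {Ω ψ : GaugeConfig 3 L SU2 → ℝ} (hΩ : IsPhys Ω) (hψ : IsPhys ψ)
    (hn : l2 Ω Ω = 1) (heig : transferApply β Ω = topValue su2Rep L β • Ω) (horth : l2 ψ Ω = 0) {m : ℕ} (hm : 1 ≤ m) :
    l2 ψ ((transferApply β)^[m] ψ) ≤ secondValue su2Rep L β ^ m * l2 ψ ψ := by
  obtain ⟨e, hon, heige, hdom, hsum, hbessel⟩ := SpecSum.exists_spectral_eigenseq (L := L) hβ
  set lam : ℕ → ℝ := fun k => levelValue su2Rep L β k with hlam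
  have hlam0 : lam 0 = topValue su2Rep L β := levelValue_zero su2Rep L β
  have hlam1 : lam 1 = secondValue su2Rep L β := levelValue_one su2Rep L β
  have hlt : lam 1 < lam 0 := by rw [hlam0, hlam1]; exact PhysL2.secondValue_lt_topValue β
  have hpos0 : 0 < lam 0 := by rw [hlam0]; exact topValue_su2Rep_pos L β
  have he0 : IsPhys (e 0 : GaugeConfig 3 L SU2 → ℝ) := (e 0).2
  -- (o) `λ_k ≤ λ₁` for `k ≥ 1`: Courant–Fischer domination applied to the eigenvector `e_k ⊥ e_0`
  have hanti : ∀ k, 1 ≤ k → lam k ≤ lam 1 := by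
    intro k hk
    have hq : qform su2Rep β (e k : GaugeConfig 3 L SU2 → ℝ) (e k) = lam k := by
      rw [qform_eigen_right β (heige k), hon k k, if_pos rfl, mul_one]
    have hd := hdom 1 (e k : GaugeConfig 3 L SU2 → ℝ) (e k).2 fun i hi => by
      have hi0 : i = 0 := by omega
      rw [hon k i, if_neg (by omega)]
    rw [hq, hon k k, if_pos rfl, mul_one] at hd
    exact hd
  -- (i) `Ω ⊥ e_k` for `k ≥ 1` (distinct eigenvalues of the symmetric operator)
  have hΩe : ∀ k, 1 ≤ k → l2 Ω (e k : GaugeConfig 3 L SU2 → ℝ) = 0 := by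
    intro k hk
    have hk' : lam k < lam 0 := lt_of_le_of_lt (hanti k hk) hlt
    have h1 : l2 (transferApply β Ω) (e k : GaugeConfig 3 L SU2 → ℝ) = lam 0 * l2 Ω (e k : GaugeConfig 3 L SU2 → ℝ) := by
      rw [heig, l2_smul_left, hlam0]
    have h2 : l2 Ω (transferApply β (e k : GaugeConfig 3 L SU2 → ℝ)) = lam k * l2 Ω (e k : GaugeConfig 3 L SU2 → ℝ) := by
      rw [heige k, l2_comm, l2_smul_left, l2_comm]
    have h := l2_transferApply_comm β hΩ (e k).2
    rw [h1, h2] at h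
    have : (lam 0 - lam k) * l2 Ω (e k : GaugeConfig 3 L SU2 → ℝ) = 0 := by linarith
    rcases mul_eq_zero.1 this with h0 | h0
    · exact absurd (sub_eq_zero.1 h0) hk'.ne'
    · exact h0
  -- (ii) `⟨Ω, e_0⟩² = 1`
  set d := l2 Ω (e 0 : GaugeConfig 3 L SU2 → ℝ) with hd
  have hd2 : d ^ 2 = 1 := by
    have hS := hsum Ω Ω hΩ hΩ 0 1 (by norm_num)
    simp only [Function.iterate_zero, id_eq, Function.iterate_one, zero_add, pow_one] at hS
    have hsingle : HasSum (fun k => lam k * l2 Ω (e k : GaugeConfig 3 L SU2 → ℝ) * l2 Ω (e k : GaugeConfig 3 L SU2 → ℝ))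
        (lam 0 * d * d) := by
      refine hasSum_single 0 fun k hk => ?_
      rw [hΩe k (Nat.one_le_iff_ne_zero.2 hk), mul_zero]
    have h1 : l2 Ω (transferApply β Ω) = lam 0 := by rw [heig, l2_comm, l2_smul_left, hn, mul_one, hlam0]
    have h2 := hS.unique hsingle
    rw [h1] at h2
    have : lam 0 * (d ^ 2 - 1) = 0 := by rw [mul_sub, mul_one, sq, ← mul_assoc]; linarith
    rcases mul_eq_zero.1 this with h | h
    · exact absurd h hpos0.ne'
    · linarith
  -- (iii) `e_0 = d·Ω` in `L²`, hence `⟨ψ, e_0⟩ = d⟨ψ,Ω⟩ = 0`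
  have hdiff0 : l2 ((e 0 : GaugeConfig 3 L SU2 → ℝ) + (-d) • Ω) ((e 0 : GaugeConfig 3 L SU2 → ℝ) + (-d) • Ω) = 0 := by
    rw [l2_add_smul_add_smul he0 he0 hΩ, hon 0 0, if_pos rfl, hn, l2_comm _ Ω, ← hd]
    nlinarith [hd2]
  have hc0 : l2 ψ (e 0 : GaugeConfig 3 L SU2 → ℝ) = 0 := by
    have hcs := sq_l2_le hψ (he0.add (hΩ.smul (-d)))
    rw [hdiff0, mul_zero] at hcs
    have hz : l2 ψ ((e 0 : GaugeConfig 3 L SU2 → ℝ) + (-d) • Ω) = 0 := by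
      nlinarith [sq_nonneg (l2 ψ ((e 0 : GaugeConfig 3 L SU2 → ℝ) + (-d) • Ω))]
    rw [l2_comm, l2_add_left he0 (hΩ.smul (-d)) hψ, l2_smul_left, l2_comm Ω ψ, horth, mul_zero, add_zero, l2_comm] at hz
    exact hz
  -- (iv) the spectral sum for `⟨ψ, K^m ψ⟩` and its termwise domination
  have hS := hsum ψ ψ hψ hψ 0 m (by omega)
  simp only [Function.iterate_zero, id_eq, zero_add] at hS
  obtain ⟨hsumm, hB⟩ := hbessel ψ hψ
  have hT : HasSum (fun k => secondValue su2Rep L β ^ m * l2 ψ (e k : GaugeConfig 3 L SU2 → ℝ) ^ 2)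
      (secondValue su2Rep L β ^ m * ∑' k, l2 ψ (e k : GaugeConfig 3 L SU2 → ℝ) ^ 2) := hsumm.hasSum.mul_left _
  have hle : ∀ k, lam k ^ m * l2 ψ (e k : GaugeConfig 3 L SU2 → ℝ) * l2 ψ (e k : GaugeConfig 3 L SU2 → ℝ) ≤
      secondValue su2Rep L β ^ m * l2 ψ (e k : GaugeConfig 3 L SU2 → ℝ) ^ 2 := by
    intro k
    rcases Nat.eq_zero_or_pos k with rfl | hk
    · rw [hc0]; simp
    · rw [mul_assoc, ← sq]
      refine mul_le_mul_of_nonneg_right ?_ (sq_nonneg _)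
      rw [← hlam1]
      exact pow_le_pow_left₀ (levelValue_su2Rep_nonneg L hβ.le k) (hanti k hk) m
  have h1 := hasSum_le hle hS hT
  have h2 : secondValue su2Rep L β ^ m * ∑' k, l2 ψ (e k : GaugeConfig 3 L SU2 → ℝ) ^ 2 ≤ secondValue su2Rep L β ^ m * l2 ψ ψ :=
    mul_le_mul_of_nonneg_left hB (pow_nonneg (secondValue_su2Rep_nonneg L hβ.le) m)
  exact h1.trans h2

/-- Symmetry of the iterated transfer operator on physical test functions: `⟨w, K_β^m v⟩ = ⟨K_β^m w, v⟩` (spectral bilinear sums). [folklore] -/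
theorem l2_iterate_comm {β : ℝ} (hβ : 0 < β) {v w : GaugeConfig 3 L SU2 → ℝ} (hv : IsPhys v) (hw : IsPhys w) {m : ℕ} (hm : 1 ≤ m) :
    l2 w ((transferApply β)^[m] v) = l2 ((transferApply β)^[m] w) v := by
  obtain ⟨e, -, -, -, hsum, -⟩ := SpecSum.exists_spectral_eigenseq (L := L) hβ
  have h1 := hsum v w hv hw 0 m (by omega)
  have h2 := hsum v w hv hw m 0 (by omega)
  simp only [Function.iterate_zero, id_eq, zero_add, add_zero] at h1 h2
  exact h1.unique h2

/-- ★★ **The `m`-step deficit bound.**  `β > 0`; `Ω` a normalised exact ground state (`K_βΩ = λ₀Ω`); `g` a bounded measurable gauge- and twist-invariant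
multiplier; `m ≥ 1`.  With `m₁ = ⟨gΩ,Ω⟩`, `m₂ = ‖gΩ‖²`, `Var = m₂ − m₁²` and the `m`-step deficit `D_m = λ₀^m m₂ − ⟨gΩ, K_β^m(gΩ)⟩`:
`λ₀^m · Var − D_m ≤ λ₁^m · Var`.  (For `Var > 0`: `λ₁^m ≥ λ₀^m − D_m/Var`; `m = 1`: the Dirichlet principle.) [cite: ReedSimonIV1978, Thm. XIII.1] -/
theorem pow_secondValue_ge_deficit {β : ℝ} (hβ : 0 < β) {g : GaugeConfig 3 L SU2 → ℝ} (hgm : Measurable g) {Cg : ℝ}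
    (hgb : ∀ U, |g U| ≤ Cg)
    (hgg : ∀ (k : Site 3 L → SU2) (U : GaugeConfig 3 L SU2), g (gaugeTransform k U) = g U)
    (hgz : ∀ (k : Fin 3), ∀ z ∈ Subgroup.center SU2, ∀ U : GaugeConfig 3 L SU2, g (twist k z U) = g U)
    {Ω : GaugeConfig 3 L SU2 → ℝ} (hΩ : IsPhys Ω) (hn : l2 Ω Ω = 1) (heig : transferApply β Ω = topValue su2Rep L β • Ω)
    {m : ℕ} (hm : 1 ≤ m) :
    topValue su2Rep L β ^ m * (l2 (fun U => g U * Ω U) (fun U => g U * Ω U) - l2 (fun U => g U * Ω U) Ω ^ 2) -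
        (topValue su2Rep L β ^ m * l2 (fun U => g U * Ω U) (fun U => g U * Ω U) -
          l2 (fun U => g U * Ω U) ((transferApply β)^[m] (fun U => g U * Ω U)))
      ≤ secondValue su2Rep L β ^ m * (l2 (fun U => g U * Ω U) (fun U => g U * Ω U) - l2 (fun U => g U * Ω U) Ω ^ 2) := by
  set lam₀ := topValue su2Rep L β with hlam₀
  set φ : GaugeConfig 3 L SU2 → ℝ := fun U => g U * Ω U with hφdef
  have hφ : IsPhys φ := hΩ.mul_of_invariant hgm hgb hgg hgz
  set m₁ := l2 φ Ω with hm₁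
  -- the centred trial state `ψ = φ − m₁Ω ⊥ Ω`
  set ψ : GaugeConfig 3 L SU2 → ℝ := φ + (-m₁) • Ω with hψdef
  have hψ : IsPhys ψ := hφ.add (hΩ.smul (-m₁))
  have horth : l2 ψ Ω = 0 := by
    rw [hψdef, l2_add_left hφ (hΩ.smul (-m₁)) hΩ, l2_smul_left, hn, ← hm₁]; ring
  have hψψ : l2 ψ ψ = l2 φ φ - m₁ ^ 2 := by
    rw [hψdef, l2_add_smul_add_smul hφ hφ hΩ, hn, l2_comm Ω φ, ← hm₁]; ring
  -- iterates: `K^m (f + cΩ) = K^m f + cλ₀^m Ω`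
  have hTm : ∀ (f : GaugeConfig 3 L SU2 → ℝ), IsPhys f → ∀ (c : ℝ) (n : ℕ),
      (transferApply β)^[n] (f + c • Ω) = (transferApply β)^[n] f + (c * lam₀ ^ n) • Ω := by
    intro f hf c n
    induction n with
    | zero => simp
    | succ n ih =>
      rw [Function.iterate_succ_apply', ih, transferApply_add β (isPhys_iterate_transferApply β hf n) (hΩ.smul _), transferApply_smul, heig,
        smul_smul, Function.iterate_succ_apply', pow_succ]
      congr 1; ring_nf
  have hKmφ : IsPhys ((transferApply β)^[m] φ) := isPhys_iterate_transferApply β hφ m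
  have hsym : l2 Ω ((transferApply β)^[m] φ) = lam₀ ^ m * m₁ := by
    rw [l2_iterate_comm hβ hφ hΩ hm, iterate_transferApply_eigen β heig, l2_smul_left, l2_comm Ω φ, ← hm₁]
  have hiter : l2 ψ ((transferApply β)^[m] ψ) = l2 φ ((transferApply β)^[m] φ) - lam₀ ^ m * m₁ ^ 2 := by
    rw [hψdef, hTm φ hφ (-m₁) m, l2_add_smul_add_smul hφ hKmφ hΩ, hsym, hn, ← hm₁]; ring
  -- domination and assembly
  have hdom := l2_iterate_le_of_orth_ground hβ hΩ hψ hn heig horth hm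
  rw [hiter, hψψ] at hdom
  linarith

end Deficit

end Summit.QuantumFields.YangMills.Theorems.FemtoTransferGap

end
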